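import Mathlib

/-!
# SoloInformed — invariants under a group of order prime to `p` (solo-Langlands-informed, s19)

Algebraic skeleton of the descent step used twice in Part II §7.11 (14)(e)–(f3)
(THEOREM Σ (T4) at `p = 5` with `K_ε = L^{τ̃}`, PROPOSITION Σ_7 (T4)_7 with `F(ε^{1/7}) = L^{Δ̃}`):
if `L/M` is Galois with group `Δ` of order `m`, `j : Cl(M) → Cl(L)` is extension of ideals and
`N : Cl(L) → Cl(M)` the norm, then `N ∘ j = m` and `j ∘ N = Σ_{δ ∈ Δ} δ`; on the parts where `m` is
invertible this makes `j` injective with image the `Δ`-invariants.  We record the abstract statement: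
for additive commutative groups `A`, `C`, a finite family of endomorphisms `δ i` of `A`, and
homomorphisms `j : C →+ A`, `N : A →+ C` with `N (j c) = m • c` and `j (N a) = Σ i, δ i a`
(`m` = the number of indices), (1) if `m • c = 0 → c = 0` on `C` then `j` is injective, and
(2) every `a` fixed by all `δ i` has `m • a` in the range of `j` — so if `m` is invertible on `A`
the range of `j` contains all invariants (it is contained in them as soon as each `δ i ∘ j = j`).
No number theory is formalised here; this is the group-theoretic step only.
-/

namespace Summit.Langlands.Langlands.Theorems

open Finset

/-- Injectivity half: `N ∘ j = m •` and `m`-torsion-freeness of `C` force `j` injective. -/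
theorem soloInformed_extension_injective_of_torsionfree
    {A C : Type*} [AddCommGroup A] [AddCommGroup C] (m : ℕ)
    (j : C →+ A) (N : A →+ C)
    (hNj : ∀ c, N (j c) = m • c)
    (htf : ∀ c : C, m • c = 0 → c = 0) :
    Function.Injective j := by
  intro c₁ c₂ h
  have h1 : N (j (c₁ - c₂)) = 0 := by
    rw [map_sub, h, sub_self, map_zero]
  have h2 : m • (c₁ - c₂) = 0 := by rw [← hNj]; exact h1
  have h3 := htf _ h2
  exact sub_eq_zero.mp h3

/-- Surjectivity half onto invariants, up to the factor `m`: if `j ∘ N = Σ δ i` then for every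
`a` fixed by all `δ i`, `m • a = j (N a)` lies in the range of `j` (`m` = number of indices). -/
theorem soloInformed_invariant_mul_card_mem_range
    {A C : Type*} [AddCommGroup A] [AddCommGroup C] {ι : Type*} [Fintype ι]
    (δ : ι → A →+ A) (j : C →+ A) (N : A →+ C)
    (hjN : ∀ a, j (N a) = ∑ i, δ i a)
    (a : A) (ha : ∀ i, δ i a = a) :
    (Fintype.card ι) • a ∈ Set.range j := by
  refine ⟨N a, ?_⟩
  rw [hjN]
  calc ∑ i, δ i a = ∑ _i : ι, a := Finset.sum_congr rfl (fun i _ => ha i)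
    _ = (Fintype.card ι) • a := by rw [Finset.sum_const, Finset.card_univ]

/-- If moreover multiplication by `m = card ι` is bijective on `A` (e.g. `A` a finite abelian
`p`-group with `p ∤ m`), every invariant is in the range of `j`. -/
theorem soloInformed_invariant_mem_range_of_card_bijective
    {A C : Type*} [AddCommGroup A] [AddCommGroup C] {ι : Type*} [Fintype ι]
    (δ : ι → A →+ A) (j : C →+ A) (N : A →+ C)
    (hjN : ∀ a, j (N a) = ∑ i, δ i a)
    (hbij : Function.Bijective fun a : A => (Fintype.card ι) • a)
    (a : A) (ha : ∀ i, δ i a = a) :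
    a ∈ Set.range j := by
  obtain ⟨b, hb⟩ := hbij.2 a
  have hb' : (Fintype.card ι) • b = a := hb
  -- b is the unique element with m • b = a; it is again invariant because m • (δ i b) = δ i a = a
  have hb_inv : ∀ i, δ i b = b := by
    intro i
    apply hbij.1
    show (Fintype.card ι) • δ i b = (Fintype.card ι) • b
    rw [← map_nsmul, hb', ha i]
  obtain ⟨c, hc⟩ := soloInformed_invariant_mul_card_mem_range δ j N hjN b hb_inv
  exact ⟨c, by rw [hc]; exact hb'⟩

end Summit.Langlands.Langlands.Theorems
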